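import Summits.BirchSwinnertonDyer.BirchSwinnertonDyer.Theorems.KolyvaginRankRigidityAtTwoRegularRefillLawGeneral
import HarnessLib

/-!
# Crux U1 `KolyvaginBoundedDefectAtTwo` (stmt-BirchSwinnertonDyer-28083), LINE 17 `regular_core_rigidity` v3,
# stub S1b `stub_nearCoreExistenceAtTwo` — the refill law without co-cyclicity, `H_f`-SIDE torsion bounds only

Width seat `bsd-line-krr2-p2` g14 (ONE READER on S1b); `--supports stmt-BirchSwinnertonDyer-28083` (helper). THEOREMS
ONLY (abstract finite-group algebra); nothing here proves S1b, U1, a rung or BSD. BSD is NOT proved.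

`natCard_ann_le_of_cyclic_upTo` / `lozenge_refill_of_cyclic_upTo` (p682193) bound the loss of a step cut "co-cyclically up to
`2^j`" by `m₂ · m₁` with `#(H_f ∩ ker 2^j) ≤ m₁` and `#(H_tr ∩ ker 2^(j+1)) ≤ m₂`. In situ the walk has a model of
`H_f = Kum_v ≅ E[2^k]` (g13's regular eigen-lines) but none of `H_tr = 𝒯_v`; this file removes the `H_tr`-side bound:
* `natCard_inf_ker_le_of_pair` — `#(H_tr ∩ ker m) ≤ #(H_f ∩ ker m)` for a complementary Lagrangian pair under a symmetric
  non-degenerate pairing (`H_tr ∩ ker m ⊆ ann_{H_tr}(m H_f)` and `#ann_{H_tr}(m H_f) · #(m H_f) = #H_tr = #H_f`);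
* `lozenge_refill_of_cyclic_upTo_f` — the walk form with both bounds on the `H_f` side:
  `#S · #H_f ≤ m₂ · m₁ · #loc(S)² · #S'` whenever `#(H_f ∩ ker 2^j) ≤ m₁`, `#(H_f ∩ ker 2^(j+1)) ≤ m₂`.
References (locators only): [cite: MazurRubin2004, Prop. 1.3.2, §4.1] [cite: MilneADT2006, Ch. I §0 (0.19)].
Design: no definitions; axioms `propext`, `Classical.choice`, `Quot.sound`.
-/

set_option autoImplicit false
-- the Theorems namespace of this sub repeats the summit name by design (D-0017 nested layout)
set_option linter.dupNamespace false

noncomputable section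

open scoped Classical
open Function

namespace Summit.BirchSwinnertonDyer.BirchSwinnertonDyer.Theorems.KolyvaginAtTwo.RegularRefill

open Summit.BirchSwinnertonDyer.Rank1Residual.JET.Section6 (card_eq_card_inf_ker_mul_card_map)

variable {L : Type*} [AddCommGroup L]

section Lagrangian

variable {n : ℕ} (b : L →+ L →+ ZMod n)
  (hn : ∀ x : L, n • x = 0) (hsymm : ∀ x y, b x y = b y x)
  {Hf Htr : AddSubgroup L} (hdisj : Hf ⊓ Htr = ⊥) (hcod : Hf ⊔ Htr = ⊤)
  (hHf : ∀ x ∈ Hf, ∀ y ∈ Hf, b x y = 0) (hHtr : ∀ x ∈ Htr, ∀ y ∈ Htr, b x y = 0)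

include hn hsymm hcod hHf hHtr in
/-- **`#(H_tr ∩ ker m) ≤ #(H_f ∩ ker m)`** for a complementary Lagrangian pair: an `m`-torsion element of `H_tr` pairs to
zero with `m H_f`, and `#ann_{H_tr}(m H_f) = #H_tr / #(m H_f) = #H_f / #(m H_f) = #(H_f ∩ ker m)`. [cite: MilneADT2006, Ch. I §0 (0.19)] -/
theorem natCard_inf_ker_le_of_pair [Finite L] [NeZero n] (hinj : Injective b) (m : ℕ) :
    Nat.card ↥(Htr ⊓ (nsmulAddMonoidHom m : L →+ L).ker) ≤ Nat.card ↥(Hf ⊓ (nsmulAddMonoidHom m : L →+ L).ker) := by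
  set δ : L →+ L := nsmulAddMonoidHom m with hδ
  have hδ_apply : ∀ x, δ x = m • x := fun x ↦ rfl
  set mHf : AddSubgroup L := Hf.map δ with hmHf
  have hmHf_le : mHf ≤ Hf := by
    rintro _ ⟨f, hf, rfl⟩; rw [hδ_apply]; exact Hf.nsmul_mem hf m
  -- `Htr ∩ ker m ≤ ann_{Htr}(m Hf)`
  have hle : Htr ⊓ δ.ker ≤ Htr ⊓ ⨅ a ∈ mHf, (b a).ker := by
    intro t ht
    obtain ⟨htT, htk⟩ := AddSubgroup.mem_inf.mp ht
    rw [mem_inf_iInf_ker_iff]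
    refine ⟨htT, ?_⟩
    rintro _ ⟨f, hf, rfl⟩
    rw [hδ_apply, map_nsmul, AddMonoidHom.nsmul_apply, ← map_nsmul, ← hδ_apply t,
      (AddMonoidHom.mem_ker).mp htk, map_zero]
  have h1 : Nat.card ↥(Htr ⊓ ⨅ a ∈ mHf, (b a).ker) * Nat.card mHf = Nat.card Htr :=
    natCard_ann_mul_natCard b hn hsymm hcod hHf hHtr hinj mHf hmHf_le
  have h2 : Nat.card Hf = Nat.card ↥(Hf ⊓ δ.ker) * Nat.card mHf := card_eq_card_inf_ker_mul_card_map δ Hf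
  have h3 : Nat.card Hf = Nat.card Htr := natCard_eq_of_lagrangian_pair b hn hsymm hcod hHf hHtr hinj
  have hpos : 0 < Nat.card mHf := Nat.card_pos
  have h4 : Nat.card ↥(Htr ⊓ ⨅ a ∈ mHf, (b a).ker) = Nat.card ↥(Hf ⊓ δ.ker) := by
    apply Nat.eq_of_mul_eq_mul_right hpos
    rw [h1, ← h3, h2]
  exact (AddSubgroup.card_le_of_le hle).trans h4.le

include hn hsymm hdisj hcod hHf hHtr in
/-- **Walk form of the refill law without co-cyclicity, `H_f`-side bounds**: `#S · #H_f ≤ m₂ · m₁ · #loc(S)² · #S'` for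
the cut co-cyclic up to `2^j`, whenever `#(H_f ∩ ker 2^j) ≤ m₁` and `#(H_f ∩ ker 2^(j+1)) ≤ m₂`.
[cite: MazurRubin2004, Prop. 1.3.2, §4.1] -/
theorem lozenge_refill_of_cyclic_upTo_f [Finite L] [NeZero n] (hinj : Injective b) {G : Type*} [AddCommGroup G]
    (loc : G →+ L) (Rel : AddSubgroup G)
    (hX : ∀ x ∈ Rel.map loc, ∀ y ∈ Rel.map loc, b x y = 0) (hcard : Nat.card ↥(Rel.map loc) = Nat.card Hf) (j : ℕ)
    {e : L} (he : e ∈ Hf) (hcyc : ∀ f ∈ Hf, ∃ k : ℤ, (2 ^ j) • f - k • e ∈ Rel.map loc)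
    {m₁ m₂ : ℕ} (hm₁ : Nat.card ↥(Hf ⊓ (nsmulAddMonoidHom (2 ^ j) : L →+ L).ker) ≤ m₁)
    (hm₂ : Nat.card ↥(Hf ⊓ (nsmulAddMonoidHom (2 ^ (j + 1)) : L →+ L).ker) ≤ m₂) :
    Nat.card ↥(Rel ⊓ Hf.comap loc) * Nat.card Hf ≤
      m₂ * m₁ * Nat.card ↥((Rel ⊓ Hf.comap loc).map loc) ^ 2 * Nat.card ↥(Rel ⊓ Htr.comap loc) :=
  lozenge_refill_of_cyclic_upTo b hn hsymm hdisj hcod hHf hHtr hinj loc Rel hX hcard j he hcyc hm₁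
    ((natCard_inf_ker_le_of_pair b hn hsymm hcod hHf hHtr hinj (2 ^ (j + 1))).trans hm₂)

end Lagrangian

end Summit.BirchSwinnertonDyer.BirchSwinnertonDyer.Theorems.KolyvaginAtTwo.RegularRefill

end
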